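import Literature.Topology.PlanarFoliations.StarPunctures
import Literature.Topology.PlanarFoliations.ProngTailsOrder
import HarnessLib

/-!
# Ends of separatrices at star data: the limits are saddles, with prong tails

Topic: Topology / PlanarFoliations, sequel to `StarPunctures.lean` (star data: the punctures are
centres or carry prong stars), `Punctures.lean` (levels; level leaves), `ProngTails.lean`,
`ProngTailsOrder.lean`. For an open leaf of star data lying in a compact set, **a puncture which
is the ω- or α-limit set of the leaf is a saddle** (not a centre): the forward half-leaf eventually
stays in the ball of the puncture, at a constant level, which is the level of the puncture
(`StarData.nprong_ne_zero_of_omegaSet`, `StarData.nprong_ne_zero_of_alphaSet` — the argument of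
`PunctureData.exists_mem_levelLeaves_of_omegaSet_subset`, and centres have no point at their
level). Hence **the leaf ends in prong tails of the stars** (`StarData.exists_fwdTail`,
`StarData.exists_bwdTail`).

## References

* C. Camacho, A. Lins Neto, *Geometric Theory of Foliations*, Birkhäuser (1985), Ch. VII §2
  [CamachoLinsNeto1985].
-/

noncomputable section

open Set Filter Function Metric
open _root_.Topology
open Literature.Topology.FourManifolds Literature.Topology.FourManifolds.Foliation

namespace Literature.Topology.PlanarFoliations

variable {X : Type*} [TopologicalSpace X] [T2Space X] [SecondCountableTopology X] {F : Foliation ℝ X} {ι : X → ℂ}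
variable {B : Type*} [TopologicalSpace B] {M : Type*} [TopologicalSpace M] {T : Foliation B M} {g : ℂ → M}
variable {x : X} [NoncompactSpace (F.Leaf x)] {hbi : IsBiOriented F}

namespace StarData

variable (D : StarData F ι T g)

/-- **A puncture which is the ω-limit set of a leaf is a saddle.** [folklore] -/
theorem nprong_ne_zero_of_omegaSet {v : ℂ} (hv : v ∈ D.P) {C : Set ℂ} (hC : IsCompact C)
    (hmem : ∀ q : F.Leaf x, ι (Leaf.pt q) ∈ C) (hω : omegaSet hbi ι x = {v}) : D.nprong v ≠ 0 := by
  intro h0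
  have hvω : v ∈ omegaSet hbi ι x := by rw [hω]; exact mem_singleton v
  -- eventually in the ball
  obtain ⟨p, hp⟩ := PunctureData.exists_image_fwd_subset (hbi := hbi) hC hmem isOpen_ball
    (fun w hw ↦ by rw [hω] at hw; rw [mem_singleton_iff.1 hw]; exact mem_ball_self (D.rad_pos _ hv))
  have hball : ∀ q ∈ fwd hbi p, ι (Leaf.pt q) ∈ ball v (D.rad v) := fun q hq ↦ hp ⟨q, hq, rfl⟩
  -- constant level on the forward half-leaf
  have hconst : ∀ q ∈ fwd hbi p, D.level v (ι (Leaf.pt q)) = D.level v (ι (Leaf.pt p)) := fun q hq ↦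
    D.level_eq_of_isPreconnected hv (PunctureData.isPreconnected_fwd p) hball hq (mem_fwd_self p)
  -- which is the level of `v`
  have hlev : D.level v (ι (Leaf.pt p)) = D.level v v := by
    by_contra hne
    have hcl : v ∈ closure ((fun q : F.Leaf x ↦ ι (Leaf.pt q)) '' fwd hbi p) := (mem_omegaSet_iff.1 hvω) p
    have hcont := D.continuousAt_level hv (mem_ball_self (D.rad_pos _ hv))
    have hopen : ({w | D.level v w ≠ D.level v (ι (Leaf.pt p))} ∩ ball v (D.rad v)) ∈ 𝓝 v :=
      inter_mem (hcont.preimage_mem_nhds (isOpen_ne.mem_nhds (Ne.symm hne)))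
        (isOpen_ball.mem_nhds (mem_ball_self (D.rad_pos _ hv)))
    obtain ⟨w, hw, ⟨q, hq, rfl⟩⟩ := mem_closure_iff_nhds.1 hcl _ hopen
    exact hw.1 (hconst q hq)
  -- contradiction with the centre property
  exact D.centre v hv h0 (Leaf.pt p) (hball p (mem_fwd_self p)) hlev

/-- **A puncture which is the α-limit set of a leaf is a saddle.** [folklore] -/
theorem nprong_ne_zero_of_alphaSet {v : ℂ} (hv : v ∈ D.P) {C : Set ℂ} (hC : IsCompact C)
    (hmem : ∀ q : F.Leaf x, ι (Leaf.pt q) ∈ C) (hα : alphaSet hbi ι x = {v}) : D.nprong v ≠ 0 := by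
  intro h0
  have hvα : v ∈ alphaSet hbi ι x := by rw [hα]; exact mem_singleton v
  obtain ⟨p, hp⟩ := PunctureData.exists_image_bwd_subset (hbi := hbi) hC hmem isOpen_ball
    (fun w hw ↦ by rw [hα] at hw; rw [mem_singleton_iff.1 hw]; exact mem_ball_self (D.rad_pos _ hv))
  have hball : ∀ q ∈ bwd hbi p, ι (Leaf.pt q) ∈ ball v (D.rad v) := fun q hq ↦ hp ⟨q, hq, rfl⟩
  have hconst : ∀ q ∈ bwd hbi p, D.level v (ι (Leaf.pt q)) = D.level v (ι (Leaf.pt p)) := fun q hq ↦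
    D.level_eq_of_isPreconnected hv (PunctureData.isPreconnected_bwd p) hball hq (mem_bwd_self p)
  have hlev : D.level v (ι (Leaf.pt p)) = D.level v v := by
    by_contra hne
    have hcl : v ∈ closure ((fun q : F.Leaf x ↦ ι (Leaf.pt q)) '' bwd hbi p) := (mem_alphaSet_iff.1 hvα) p
    have hcont := D.continuousAt_level hv (mem_ball_self (D.rad_pos _ hv))
    have hopen : ({w | D.level v w ≠ D.level v (ι (Leaf.pt p))} ∩ ball v (D.rad v)) ∈ 𝓝 v :=
      inter_mem (hcont.preimage_mem_nhds (isOpen_ne.mem_nhds (Ne.symm hne)))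
        (isOpen_ball.mem_nhds (mem_ball_self (D.rad_pos _ hv)))
    obtain ⟨w, hw, ⟨q, hq, rfl⟩⟩ := mem_closure_iff_nhds.1 hcl _ hopen
    exact hw.1 (hconst q hq)
  exact D.centre v hv h0 (Leaf.pt p) (hball p (mem_bwd_self p)) hlev

/-- **A leaf whose ω-limit set is a puncture ends in a forward prong tail of its star.**
[cite: CamachoLinsNeto1985, Ch. VII §2] -/
theorem exists_fwdTail (hι : IsOpenEmbedding ι) {v : ℂ} (hv : v ∈ D.P) {C : Set ℂ} (hC : IsCompact C)
    (hmem : ∀ q : F.Leaf x, ι (Leaf.pt q) ∈ C) (hω : omegaSet hbi ι x = {v}) :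
    ∃ hv0 : D.nprong v ≠ 0, Nonempty ((D.star v hv0).FwdTail hbi x) := by
  have hv0 := D.nprong_ne_zero_of_omegaSet hv hC hmem hω
  haveI : NeZero (D.nprong v) := ⟨hv0⟩
  exact ⟨hv0, ProngStar.nonempty_fwdTail hι hC hmem hω⟩

/-- **A leaf whose α-limit set is a puncture starts in a backward prong tail of its star.**
[cite: CamachoLinsNeto1985, Ch. VII §2] -/
theorem exists_bwdTail (hι : IsOpenEmbedding ι) {v : ℂ} (hv : v ∈ D.P) {C : Set ℂ} (hC : IsCompact C)
    (hmem : ∀ q : F.Leaf x, ι (Leaf.pt q) ∈ C) (hα : alphaSet hbi ι x = {v}) :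
    ∃ hv0 : D.nprong v ≠ 0, Nonempty ((D.star v hv0).BwdTail hbi x) := by
  have hv0 := D.nprong_ne_zero_of_alphaSet hv hC hmem hα
  haveI : NeZero (D.nprong v) := ⟨hv0⟩
  exact ⟨hv0, ProngStar.nonempty_bwdTail hι hC hmem hα⟩

end StarData

end Literature.Topology.PlanarFoliations
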